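import Literature.Probability.Process.KolmogorovChentsov
import Mathlib.Topology.MetricSpace.Holder
import HarnessLib

/-!
# The Kolmogorov–Chentsov theorem on `ℝ≥0`: locally Hölder modification

Continuation of `Literature.Probability.Process.KolmogorovChentsov` (dyadic proof of the
Kolmogorov–Chentsov continuity theorem, Le Gall 2016, Thm 2.9).  Here we prove the Hölder part:
under `ProbabilityTheory.IsKolmogorovProcess X P p q M` with `q > 1` (values in a complete extended
metric space with its Borel σ-algebra, arbitrary measure `P`), there is a modification `Y` of `X`
with measurable marginals, all of whose paths are continuous and, on every `[0, T]`, Hölder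
continuous of *every* order `γ < (q - 1) / p`
(`Literature.Probability.Process.exists_modification_holder_of_isKolmogorovProcess`).

Compared to the continuity part, the good set of sample points is refined to
`Literature.Probability.Process.KolmogorovChentsov.goodSetH`: for every exponent of the sequence
`holderExp p q j = ((q-1)/p) (1 - 1/(j+2)) ↑ (q-1)/p` and every `N`, the increments over
consecutive level-`m` dyadics of `[0, N]` are eventually `≤ 2^(-holderExp p q j · m)`
(Borel–Cantelli, using `γ p < q - 1`).  On this set the dyadic chaining lemma gives a Hölder
modulus on the dyadics (Le Gall 2016, Lemma 2.10), which passes to the continuous extension; the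
Hölder bound on all of `[0, T]` (pairs at distance `≥ 2^(-n₀)`) is obtained by chaining finitely
many short steps, and smaller exponents by Mathlib's `HolderOnWith.of_le`.

## References

* J.-F. Le Gall, *Brownian Motion, Martingales, and Stochastic Calculus*, GTM 274 (2016),
  Thm 2.9, Lemma 2.10, Remarks (i)–(ii) p. 41.
* O. Kallenberg, *Foundations of Modern Probability* (2002), Thm 3.23.
* R. Degenne, D. Ledvinka, E. Marion, P. Pfaffelhuber, *Formalization of Brownian motion in Lean*,
  arXiv:2511.20118, §2.3, Thm 4.21.
-/

open MeasureTheory ProbabilityTheory Filter Set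
open scoped ENNReal NNReal Topology

namespace Literature.Probability.Process

namespace KolmogorovChentsov

variable {E : Type*} [PseudoEMetricSpace E]

/-! ### Scale-`n` modulus bound and Hölder bound on the dyadics -/

/-- The scale-`n` modulus bound derived from the chaining lemma: if the increments over
consecutive level-`m` dyadics of `[0, N]` are `≤ δ m` for `m > n₀`, then dyadic points
`s, t ≤ N` at distance `< 2⁻ⁿ`, `n ≥ n₀`, satisfy `edist (f s) (f t) ≤ 2 ∑' i, δ (n + 1 + i)`
(reduction to a common level, then `chain`). [cite: Legall2016, Lemma 2.10] -/
theorem edist_le_tsum_of_increments_le {f : ℝ≥0 → E} {δ : ℕ → ℝ≥0∞} {N n₀ n : ℕ}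
    (hn : n₀ ≤ n)
    (h : ∀ m, n₀ < m → ∀ k, k + 1 ≤ N * 2 ^ m → edist (f (dyad m k)) (f (dyad m (k + 1))) ≤ δ m)
    {s t : ℝ≥0} (hs : s ∈ dyadics) (ht : t ∈ dyadics) (hsN : s ≤ N) (htN : t ≤ N)
    (hd : dist s t < (2 ^ n)⁻¹) :
    edist (f s) (f t) ≤ 2 * ∑' i, δ (n + 1 + i) := by
  -- reduce to a common level `m ≥ n` and `a ≤ b`
  suffices key : ∀ m, n ≤ m → ∀ a b, a ≤ b → dyad m b ≤ N →
      dist (dyad m a) (dyad m b) < (2 ^ n)⁻¹ →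
      edist (f (dyad m a)) (f (dyad m b)) ≤ 2 * ∑' i, δ (n + 1 + i) by
    obtain ⟨m₁, a₁, rfl⟩ := hs
    obtain ⟨m₂, b₁, rfl⟩ := ht
    set m := max n (max m₁ m₂) with hm
    have hm₁ : m₁ ≤ m := le_max_of_le_right (le_max_left _ _)
    have hm₂ : m₂ ≤ m := le_max_of_le_right (le_max_right _ _)
    obtain ⟨a, ha⟩ : ∃ a, dyad m₁ a₁ = dyad m a :=
      ⟨2 ^ (m - m₁) * a₁, by rw [← dyad_add_mul m₁ (m - m₁) a₁, Nat.add_sub_cancel' hm₁]⟩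
    obtain ⟨b, hb⟩ : ∃ b, dyad m₂ b₁ = dyad m b :=
      ⟨2 ^ (m - m₂) * b₁, by rw [← dyad_add_mul m₂ (m - m₂) b₁, Nat.add_sub_cancel' hm₂]⟩
    rw [ha] at hsN hd ⊢
    rw [hb] at htN hd ⊢
    rcases le_total a b with hab | hab
    · exact key m (le_max_left _ _) a b hab htN hd
    · rw [edist_comm]
      rw [dist_comm] at hd
      exact key m (le_max_left _ _) b a hab hsN hd
  intro m hm a b hab hb hd
  rw [dyad_le_natCast_iff] at hb
  have hba : b - a < 2 ^ (m - n) := by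
    rw [dist_dyad, abs_sub_comm, abs_of_nonneg (by simpa using hab), div_lt_iff₀ (by positivity),
      ← one_div, div_mul_eq_mul_div, one_mul, lt_div_iff₀ (by positivity)] at hd
    have : ((b - a : ℕ) : ℝ) < 2 ^ (m - n) := by
      rw [Nat.cast_sub hab, lt_iff_not_ge]
      intro hle
      have := (mul_le_mul_of_nonneg_right hle (by positivity : (0 : ℝ) ≤ 2 ^ n)).trans_lt hd
      rw [← pow_add, Nat.sub_add_cancel hm] at this
      exact lt_irrefl _ this
    exact_mod_cast this
  have hchain := chain (f := f) (δ := δ) (N := N) (n := n)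
    (fun m hm k hk ↦ h m (lt_of_le_of_lt hn hm) k hk) m hm a b hab hb hba
  refine hchain.trans ?_
  gcongr
  exact ENNReal.sum_le_tsum _

/-- Powers of `2 : ℝ≥0∞` with real exponents: `((2⁻¹) ^ n) ^ γ = (2 ^ (-γ)) ^ n`. [folklore] -/
theorem inv_two_pow_rpow (n : ℕ) (γ : ℝ) :
    (((2 : ℝ≥0∞)⁻¹) ^ n) ^ γ = ((2 : ℝ≥0∞) ^ (-γ)) ^ n := by
  rw [← ENNReal.rpow_natCast, ← ENNReal.rpow_natCast, ENNReal.inv_rpow, ← ENNReal.rpow_neg,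
    ← ENNReal.rpow_mul, ← ENNReal.rpow_mul]
  congr 1
  ring

/-- `edist s t` in `ℝ≥0` dominates `(2⁻¹)^(n+1)` when `(2^(n+1))⁻¹ ≤ dist s t`. [folklore] -/
theorem inv_two_pow_le_edist {s t : ℝ≥0} {n : ℕ} (h : (2 ^ n)⁻¹ ≤ dist s t) :
    ((2 : ℝ≥0∞)⁻¹) ^ n ≤ edist s t := by
  rw [edist_dist, ← ENNReal.ofReal_ofNat, ← ENNReal.ofReal_inv_of_pos (by positivity),
    ← ENNReal.ofReal_pow (by positivity), inv_pow]
  exact ENNReal.ofReal_le_ofReal h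

/-- **Hölder bound on the dyadics** (Le Gall 2016, Lemma 2.10 and proof of Thm 2.9): if the
increments over consecutive level-`m` dyadics of `[0, N]` are `≤ 2^(-γ m)` for all `m > n₀`
(`γ > 0`), then for dyadic `s, t ≤ N` at distance `< 2^(-n₀)`,
`edist (f s) (f t) ≤ 2 (1 - 2^(-γ))⁻¹ · edist s t ^ γ`. [cite: Legall2016, Lemma 2.10] -/
theorem edist_le_mul_rpow_of_increments_le {f : ℝ≥0 → E} {γ : ℝ} (hγ : 0 < γ) {N n₀ : ℕ}
    (h : ∀ m, n₀ < m → ∀ k, k + 1 ≤ N * 2 ^ m →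
      edist (f (dyad m k)) (f (dyad m (k + 1))) ≤ ((2 : ℝ≥0∞) ^ (-γ)) ^ m)
    {s t : ℝ≥0} (hs : s ∈ dyadics) (ht : t ∈ dyadics) (hsN : s ≤ N) (htN : t ≤ N)
    (hd : dist s t < (2 ^ n₀)⁻¹) :
    edist (f s) (f t) ≤ 2 * (1 - (2 : ℝ≥0∞) ^ (-γ))⁻¹ * edist s t ^ γ := by
  rcases eq_or_ne s t with rfl | hst
  · simp
  have hdpos : 0 < dist s t := dist_pos.2 hst
  -- the scale `n`: the least `n` with `(2 ^ (n + 1))⁻¹ ≤ dist s t`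
  have hex : ∃ n : ℕ, (2 ^ (n + 1) : ℝ)⁻¹ ≤ dist s t := by
    obtain ⟨n, hn⟩ := exists_pow_lt_of_lt_one hdpos (by norm_num : (2⁻¹ : ℝ) < 1)
    exact ⟨n, by
      rw [← inv_pow]
      exact ((pow_le_pow_of_le_one (by norm_num) (by norm_num) (Nat.le_succ n)).trans hn.le)⟩
  classical
  set n := Nat.find hex with hn
  have hn₁ : (2 ^ (n + 1) : ℝ)⁻¹ ≤ dist s t := Nat.find_spec hex
  have hn₂ : dist s t < (2 ^ n : ℝ)⁻¹ := by
    rcases Nat.eq_zero_or_eq_succ_pred n with h0 | hsucc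
    · rw [h0, pow_zero, inv_one]
      exact hd.trans_le (by
        rw [inv_le_one_iff₀]; exact Or.inr (one_le_pow₀ (by norm_num)))
    · have := Nat.find_min hex (m := n.pred) (by omega)
      rw [not_le] at this
      rwa [hsucc]
  have hn₀ : n₀ ≤ n := by
    by_contra hlt
    rw [not_le] at hlt
    have : (2 ^ n₀ : ℝ)⁻¹ ≤ (2 ^ (n + 1) : ℝ)⁻¹ := by
      rw [← inv_pow, ← inv_pow]
      exact pow_le_pow_of_le_one (by norm_num) (by norm_num) (by omega)
    exact lt_irrefl _ ((this.trans hn₁).trans_lt hd)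
  set r : ℝ≥0∞ := (2 : ℝ≥0∞) ^ (-γ) with hr
  have hmain := edist_le_tsum_of_increments_le (δ := fun m ↦ r ^ m) hn₀ h hs ht hsN htN hn₂
  have htsum : ∑' i, r ^ (n + 1 + i) = r ^ (n + 1) * (1 - r)⁻¹ := by
    simp_rw [pow_add]
    rw [ENNReal.tsum_mul_left, ENNReal.tsum_geometric, ← pow_add]
  rw [htsum] at hmain
  have hrn : r ^ (n + 1) ≤ edist s t ^ γ := by
    rw [hr, ← inv_two_pow_rpow]
    exact ENNReal.rpow_le_rpow (inv_two_pow_le_edist hn₁) hγ.le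
  calc edist (f s) (f t) ≤ 2 * (r ^ (n + 1) * (1 - r)⁻¹) := hmain
    _ ≤ 2 * (edist s t ^ γ * (1 - r)⁻¹) := by gcongr
    _ = 2 * (1 - r)⁻¹ * edist s t ^ γ := by ring

/-! ### From the dyadics to all times: continuity and finitely many short steps -/

/-- The level-`m` dyadic approximation from below is below the point. [folklore] -/
theorem dyad_floor_le (s : ℝ≥0) (m : ℕ) : dyad m ⌊(s : ℝ) * 2 ^ m⌋₊ ≤ s := by
  rw [← NNReal.coe_le_coe, coe_dyad, div_le_iff₀ (by positivity)]
  exact Nat.floor_le (by positivity)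

/-- A near-diagonal Hölder bound on the dyadics of `[0, N]` passes to all points of `[0, N]` for a
continuous path (approximate from below by dyadics and pass to the limit). [folklore] -/
theorem edist_le_mul_rpow_of_dyadics {g : ℝ≥0 → E} (hg : Continuous g) {C : ℝ≥0∞} (hC : C ≠ ∞)
    {γ : ℝ} {N : ℕ} {ρ : ℝ}
    (h : ∀ s ∈ dyadics, ∀ t ∈ dyadics, s ≤ N → t ≤ N → dist s t < ρ →
      edist (g s) (g t) ≤ C * edist s t ^ γ)
    {s t : ℝ≥0} (hs : s ≤ N) (ht : t ≤ N) (hd : dist s t < ρ) :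
    edist (g s) (g t) ≤ C * edist s t ^ γ := by
  set u : ℝ≥0 → ℕ → ℝ≥0 := fun x m ↦ dyad m ⌊(x : ℝ) * 2 ^ m⌋₊ with hu
  have hus : Tendsto (u s) atTop (𝓝 s) := (tendsto_dyad_floor s).mono_right nhdsWithin_le_nhds
  have hut : Tendsto (u t) atTop (𝓝 t) := (tendsto_dyad_floor t).mono_right nhdsWithin_le_nhds
  have hL : Tendsto (fun m ↦ edist (g (u s m)) (g (u t m))) atTop (𝓝 (edist (g s) (g t))) :=
    ((hg.tendsto s).comp hus).edist ((hg.tendsto t).comp hut)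
  have hR : Tendsto (fun m ↦ C * edist (u s m) (u t m) ^ γ) atTop (𝓝 (C * edist s t ^ γ)) :=
    ENNReal.Tendsto.const_mul ((ENNReal.continuous_rpow_const.tendsto _).comp (hus.edist hut))
      (Or.inr hC)
  refine le_of_tendsto_of_tendsto hL hR ?_
  have hev : ∀ᶠ m in atTop, dist (u s m) (u t m) < ρ :=
    ((continuous_dist.tendsto (s, t)).comp (hus.prodMk_nhds hut)).eventually (gt_mem_nhds hd)
  filter_upwards [hev] with m hm
  exact h _ (dyad_mem_dyadics _ _) _ (dyad_mem_dyadics _ _) ((dyad_floor_le s m).trans hs)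
    ((dyad_floor_le t m).trans ht) hm

/-- Chaining finitely many short steps: a near-diagonal bound `edist (g s) (g t) ≤ B` for
`s ≤ t ≤ T`, `t - s ≤ ρ'`, gives `edist (g s) (g t) ≤ i B` whenever `t - s ≤ i ρ'`. [folklore] -/
theorem edist_le_mul_of_steps {g : ℝ≥0 → E} {B : ℝ≥0∞} {T ρ' : ℝ≥0}
    (h : ∀ s t : ℝ≥0, s ≤ t → t ≤ T → t - s ≤ ρ' → edist (g s) (g t) ≤ B) :
    ∀ (i : ℕ) (s t : ℝ≥0), s ≤ t → t ≤ T → t - s ≤ i * ρ' → edist (g s) (g t) ≤ i * B := by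
  intro i
  induction i with
  | zero =>
    intro s t hst htT hts
    obtain rfl : s = t := le_antisymm hst (tsub_eq_zero_iff_le.1 (by simpa using hts))
    simp
  | succ i ih =>
    intro s t hst htT hts
    by_cases hshort : t - s ≤ ρ'
    · calc edist (g s) (g t) ≤ B := h s t hst htT hshort
        _ ≤ (i + 1 : ℕ) * B := by
            rw [Nat.cast_succ]
            exact le_mul_of_one_le_left zero_le (by simp)
    · rw [not_le] at hshort
      set s' := s + ρ' with hs'
      have hs't : s' ≤ t := by
        rw [hs']
        calc s + ρ' ≤ s + (t - s) := by gcongr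
          _ = t := add_tsub_cancel_of_le hst
      have h1 : edist (g s) (g s') ≤ B := h s s' le_self_add (hs't.trans htT) (by simp [hs'])
      have h2 : edist (g s') (g t) ≤ i * B := by
        refine ih s' t hs't htT ?_
        rw [hs', tsub_le_iff_right]
        calc t = t - s + s := (tsub_add_cancel_of_le hst).symm
          _ ≤ (i + 1 : ℕ) * ρ' + s := by gcongr
          _ = i * ρ' + (s + ρ') := by push_cast; ring
      calc edist (g s) (g t) ≤ edist (g s) (g s') + edist (g s') (g t) := edist_triangle _ _ _
        _ ≤ B + i * B := add_le_add h1 h2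
        _ = (i + 1 : ℕ) * B := by push_cast; ring

/-- A path with a near-diagonal Hölder bound on `[0, T]` (pairs at distance `< ρ`) is Hölder on
`[0, T]`: distant pairs are handled by chaining finitely many short steps. [folklore] -/
theorem exists_holderOnWith_of_local {g : ℝ≥0 → E} {C : ℝ≥0∞} (hC : C ≠ ∞) {γ : ℝ≥0}
    {T : ℝ≥0} {ρ : ℝ} (hρ : 0 < ρ)
    (h : ∀ s t : ℝ≥0, s ≤ T → t ≤ T → dist s t < ρ → edist (g s) (g t) ≤ C * edist s t ^ (γ : ℝ)) :
    ∃ C' : ℝ≥0, HolderOnWith C' γ g (Icc 0 T) := by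
  -- short steps of length `ρ' = ρ / 2`
  set ρ' : ℝ≥0 := ⟨ρ / 2, (half_pos hρ).le⟩ with hρ'
  have hρ'val : (ρ' : ℝ) = ρ / 2 := rfl
  have hρ'pos : (0 : ℝ) < ρ' := by rw [hρ'val]; exact half_pos hρ
  have hρ'lt : (ρ' : ℝ) < ρ := by rw [hρ'val]; exact half_lt_self hρ
  set B : ℝ≥0∞ := C * (ENNReal.ofReal ρ') ^ (γ : ℝ) with hB
  have hBtop : B ≠ ∞ :=
    ENNReal.mul_ne_top hC (ENNReal.rpow_ne_top_of_nonneg γ.2 ENNReal.ofReal_ne_top)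
  have hstep : ∀ s t : ℝ≥0, s ≤ t → t ≤ T → t - s ≤ ρ' → edist (g s) (g t) ≤ B := by
    intro s t hst htT hts
    have hdist : dist s t ≤ ρ' := by
      rw [dist_comm, NNReal.dist_eq, abs_of_nonneg (by simpa using hst)]
      have := NNReal.coe_le_coe.2 hts
      rwa [NNReal.coe_sub hst] at this
    calc edist (g s) (g t) ≤ C * edist s t ^ (γ : ℝ) :=
          h s t (hst.trans htT) htT (hdist.trans_lt hρ'lt)
      _ ≤ C * (ENNReal.ofReal ρ') ^ (γ : ℝ) := by
          gcongr
          rw [edist_dist]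
          exact ENNReal.ofReal_le_ofReal hdist
  -- global bound `D` on `[0, T]`
  set K : ℕ := ⌈(T : ℝ) / ρ'⌉₊ with hK
  have hTK : T ≤ K * ρ' := by
    rw [← NNReal.coe_le_coe, NNReal.coe_mul, NNReal.coe_natCast, ← div_le_iff₀ hρ'pos]
    exact Nat.le_ceil _
  set D : ℝ≥0∞ := K * B with hD
  have hDtop : D ≠ ∞ := ENNReal.mul_ne_top (ENNReal.natCast_ne_top K) hBtop
  have hfar : ∀ s ∈ Icc (0 : ℝ≥0) T, ∀ t ∈ Icc (0 : ℝ≥0) T, edist (g s) (g t) ≤ D := by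
    suffices key : ∀ s t : ℝ≥0, s ≤ t → t ≤ T → edist (g s) (g t) ≤ D by
      intro s hs t ht
      rcases le_total s t with hst | hts
      · exact key s t hst ht.2
      · rw [edist_comm]; exact key t s hts hs.2
    intro s t hst htT
    exact edist_le_mul_of_steps hstep K s t hst htT ((tsub_le_self.trans htT).trans hTK)
  -- the constant
  set C' : ℝ≥0∞ := max C (D / (ENNReal.ofReal ρ) ^ (γ : ℝ)) with hC'
  have hργ0 : (ENNReal.ofReal ρ) ^ (γ : ℝ) ≠ 0 :=
    (ENNReal.rpow_pos (ENNReal.ofReal_pos.2 hρ) ENNReal.ofReal_ne_top).ne'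
  have hργtop : (ENNReal.ofReal ρ) ^ (γ : ℝ) ≠ ∞ :=
    ENNReal.rpow_ne_top_of_nonneg γ.2 ENNReal.ofReal_ne_top
  have hC'top : C' ≠ ∞ := by
    rw [hC']
    exact max_ne_top hC (ENNReal.div_ne_top hDtop hργ0)
  refine ⟨C'.toNNReal, fun x hx y hy ↦ ?_⟩
  rw [ENNReal.coe_toNNReal hC'top]
  by_cases hxy : dist x y < ρ
  · calc edist (g x) (g y) ≤ C * edist x y ^ (γ : ℝ) := h x y hx.2 hy.2 hxy
      _ ≤ C' * edist x y ^ (γ : ℝ) := by gcongr; exact le_max_left _ _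
  · rw [not_lt] at hxy
    have hρxy : ENNReal.ofReal ρ ≤ edist x y := by
      rw [edist_dist]; exact ENNReal.ofReal_le_ofReal hxy
    calc edist (g x) (g y) ≤ D := hfar x hx y hy
      _ = D / (ENNReal.ofReal ρ) ^ (γ : ℝ) * (ENNReal.ofReal ρ) ^ (γ : ℝ) :=
          (ENNReal.div_mul_cancel hργ0 hργtop).symm
      _ ≤ C' * edist x y ^ (γ : ℝ) := by
          gcongr
          · exact le_max_right _ _

/-! ### Borel–Cantelli with a general exponent -/

section Estimates

variable {Ω : Type*} {mΩ : MeasurableSpace Ω} {P : Measure Ω} {p q : ℝ} {M : ℝ≥0}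
  {X : ℝ≥0 → Ω → E}

/-- Exponent bookkeeping for the Borel–Cantelli step with threshold `2^(-γ m)`:
`2^m · (M (2⁻ᵐ)^q / ((2^(-γ))^m)^p) = M · (2^(-(q - 1 - γ p)))^m`. [folklore] -/
theorem card_mul_bound_rpow_eq (γ : ℝ) (m : ℕ) :
    (2 : ℝ≥0∞) ^ m * ((M : ℝ≥0∞) * ((2 : ℝ≥0∞)⁻¹ ^ m) ^ q / (((2 : ℝ≥0∞) ^ (-γ)) ^ m) ^ p)
      = M * ((2 : ℝ≥0∞) ^ (-(q - 1 - γ * p))) ^ m := by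
  have e1 : ((2 : ℝ≥0∞)⁻¹ ^ m) ^ q = 2 ^ (-(m * q)) := by
    rw [← ENNReal.rpow_natCast, ← ENNReal.rpow_mul, ENNReal.inv_rpow, ← ENNReal.rpow_neg]
  have e2 : (((2 : ℝ≥0∞) ^ (-γ)) ^ m) ^ p = 2 ^ (-(γ * m * p)) := by
    rw [← ENNReal.rpow_natCast, ← ENNReal.rpow_mul, ← ENNReal.rpow_mul]
    congr 1
    ring
  have e3 : ((2 : ℝ≥0∞) ^ (-(q - 1 - γ * p))) ^ m = 2 ^ (-(q - 1 - γ * p) * m) := by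
    rw [← ENNReal.rpow_natCast, ← ENNReal.rpow_mul]
  have e4 : (2 : ℝ≥0∞) ^ m = 2 ^ (m : ℝ) := (ENNReal.rpow_natCast _ _).symm
  rw [e1, e2, e3, e4, ENNReal.div_eq_inv_mul, ← ENNReal.rpow_neg, neg_neg]
  calc (2 : ℝ≥0∞) ^ (m : ℝ) * (2 ^ (γ * m * p) * (M * 2 ^ (-(m * q))))
      = M * (2 ^ (m : ℝ) * 2 ^ (γ * m * p) * 2 ^ (-(m * q))) := by ring
    _ = M * 2 ^ (-(q - 1 - γ * p) * m) := by
        rw [← ENNReal.rpow_add _ _ two_ne_zero ENNReal.ofNat_ne_top,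
          ← ENNReal.rpow_add _ _ two_ne_zero ENNReal.ofNat_ne_top]
        congr 2
        ring

/-- **Borel–Cantelli step with exponent `γ`, `γ p < q - 1`** (Le Gall 2016, proof of Thm 2.9):
for every `N`, almost surely, for all sufficiently fine levels `m`, every increment of the path
over consecutive level-`m` dyadics of `[0, N]` is at most `2^(-γ m)`.
[cite: Legall2016, Thm 2.9] -/
theorem ae_eventually_increments_le_rpow (hX : IsKolmogorovProcess X P p q M) {γ : ℝ}
    (hγ : γ * p < q - 1) (N : ℕ) :
    ∀ᵐ ω ∂P, ∀ᶠ m in atTop, ∀ k, k + 1 ≤ N * 2 ^ m →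
      edist (X (dyad m k) ω) (X (dyad m (k + 1)) ω) ≤ ((2 : ℝ≥0∞) ^ (-γ)) ^ m := by
  set r : ℝ≥0∞ := (2 : ℝ≥0∞) ^ (-γ) with hr
  have hr0 : r ≠ 0 := by simp [hr, ENNReal.rpow_eq_zero_iff]
  have hrtop : r ≠ ∞ := by simp [hr, ENNReal.rpow_eq_top_iff]
  set A : ℕ → Set Ω := fun m ↦ ⋃ k ∈ Finset.range (N * 2 ^ m),
    {ω | r ^ m < edist (X (dyad m k) ω) (X (dyad m (k + 1)) ω)} with hA
  have hbound : ∀ m, P (A m) ≤ N * (M * ((2 : ℝ≥0∞) ^ (-(q - 1 - γ * p))) ^ m) := by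
    intro m
    have hk : ∀ k, P {ω | r ^ m < edist (X (dyad m k) ω) (X (dyad m (k + 1)) ω)}
        ≤ (M : ℝ≥0∞) * ((2 : ℝ≥0∞)⁻¹ ^ m) ^ q / (r ^ m) ^ p := by
      intro k
      have hsub : {ω | r ^ m < edist (X (dyad m k) ω) (X (dyad m (k + 1)) ω)}
          ⊆ {ω | r ^ m ≤ edist (X (dyad m k) ω) (X (dyad m (k + 1)) ω)} :=
        fun ω hω ↦ Set.mem_setOf.2 (le_of_lt (Set.mem_setOf.1 hω))
      rw [ENNReal.le_div_iff_mul_le (Or.inl _) (Or.inl _), mul_comm]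
      · calc (r ^ m) ^ p * P {ω | r ^ m < edist (X (dyad m k) ω) (X (dyad m (k + 1)) ω)}
            ≤ (r ^ m) ^ p * P {ω | r ^ m ≤ edist (X (dyad m k) ω) (X (dyad m (k + 1)) ω)} :=
              mul_le_mul_right (measure_mono hsub) _
          _ ≤ M * edist (dyad m k) (dyad m (k + 1)) ^ q := rpow_mul_measure_le hX _ _ _
          _ = M * ((2 : ℝ≥0∞)⁻¹ ^ m) ^ q := by rw [edist_dyad_succ]
      · exact (ENNReal.rpow_pos (ENNReal.pow_pos (pos_iff_ne_zero.2 hr0) _)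
          (ENNReal.pow_ne_top hrtop)).ne'
      · exact ENNReal.rpow_ne_top_of_nonneg hX.p_pos.le (ENNReal.pow_ne_top hrtop)
    calc P (A m) ≤ ∑ k ∈ Finset.range (N * 2 ^ m),
          P {ω | r ^ m < edist (X (dyad m k) ω) (X (dyad m (k + 1)) ω)} :=
          measure_biUnion_finset_le _ _
      _ ≤ ∑ _k ∈ Finset.range (N * 2 ^ m),
          (M : ℝ≥0∞) * ((2 : ℝ≥0∞)⁻¹ ^ m) ^ q / (r ^ m) ^ p :=
          Finset.sum_le_sum fun k _ ↦ hk k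
      _ = N * ((2 : ℝ≥0∞) ^ m * ((M : ℝ≥0∞) * ((2 : ℝ≥0∞)⁻¹ ^ m) ^ q / (r ^ m) ^ p)) := by
          rw [Finset.sum_const, Finset.card_range, nsmul_eq_mul]
          push_cast
          ring
      _ = N * (M * ((2 : ℝ≥0∞) ^ (-(q - 1 - γ * p))) ^ m) := by
          rw [hr, card_mul_bound_rpow_eq]
  have hsum : ∑' m, P (A m) ≠ ∞ := by
    have hρ : (2 : ℝ≥0∞) ^ (-(q - 1 - γ * p)) < 1 :=
      ENNReal.rpow_lt_one_of_one_lt_of_neg ENNReal.one_lt_two (by linarith)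
    refine ne_top_of_le_ne_top ?_ (ENNReal.tsum_le_tsum hbound)
    rw [ENNReal.tsum_mul_left, ENNReal.tsum_mul_left, ENNReal.tsum_geometric]
    exact ENNReal.mul_ne_top (ENNReal.natCast_ne_top N) (ENNReal.mul_ne_top ENNReal.coe_ne_top
      (ENNReal.inv_ne_top.2 (tsub_pos_of_lt hρ).ne'))
  filter_upwards [ae_eventually_notMem hsum] with ω hω
  filter_upwards [hω] with m hm k hk
  simp only [hA, Set.mem_iUnion, Finset.mem_range, Set.mem_setOf_eq, not_exists, not_lt,
    exists_prop, not_and] at hm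
  exact hm k (by omega)

end Estimates

/-! ### The exponent sequence and the refined good set -/

/-- The sequence of Hölder exponents `((q - 1) / p) (1 - 1 / (j + 2)) ↑ (q - 1) / p`.
[folklore] -/
noncomputable def holderExp (p q : ℝ) (j : ℕ) : ℝ := (q - 1) / p * (1 - 1 / (j + 2))

section Exponents

variable {p q : ℝ}

/-- The exponents are positive. [folklore] -/
theorem holderExp_pos (hp : 0 < p) (hq : 1 < q) (j : ℕ) : 0 < holderExp p q j := by
  have hj : (1 : ℝ) / (j + 2) < 1 := by
    rw [div_lt_one (by positivity)]; linarith [j.cast_nonneg (α := ℝ)]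
  exact mul_pos (div_pos (by linarith) hp) (by linarith)

/-- The exponents satisfy the Borel–Cantelli constraint `γ p < q - 1`. [folklore] -/
theorem holderExp_mul_lt (hp : 0 < p) (hq : 1 < q) (j : ℕ) : holderExp p q j * p < q - 1 := by
  have hj : 0 < (1 : ℝ) / (j + 2) := by positivity
  rw [holderExp, mul_comm, ← mul_assoc, mul_div_cancel₀ _ hp.ne']
  nlinarith

/-- The first exponent is `(q - 1) / (2 p)`, the exponent of `rate p q`. [folklore] -/
theorem holderExp_zero : holderExp p q 0 = (q - 1) / (2 * p) := by
  rw [holderExp]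
  ring

/-- `2 ^ (-holderExp p q 0) = rate p q`. [folklore] -/
theorem two_rpow_neg_holderExp_zero : (2 : ℝ≥0∞) ^ (-holderExp p q 0) = rate p q := by
  rw [holderExp_zero, rate]

/-- Every `γ < (q - 1) / p` is dominated by some exponent of the sequence. [folklore] -/
theorem exists_le_holderExp (hp : 0 < p) (hq : 1 < q) {γ : ℝ} (hγ : γ < (q - 1) / p) :
    ∃ j : ℕ, γ ≤ holderExp p q j := by
  have hc : 0 < (q - 1) / p := div_pos (by linarith) hp
  -- need `1 / (j + 2) ≤ 1 - γ / ((q - 1) / p)`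
  have hε : 0 < 1 - γ / ((q - 1) / p) := by
    rw [sub_pos, div_lt_one hc]; exact hγ
  obtain ⟨j, hj⟩ := exists_nat_one_div_lt hε
  refine ⟨j, ?_⟩
  rw [holderExp]
  have h1 : (1 : ℝ) / (j + 2) ≤ 1 / (j + 1) :=
    one_div_le_one_div_of_le (by positivity) (by linarith)
  have h2 : γ / ((q - 1) / p) ≤ 1 - 1 / (j + 2) := by linarith
  rw [div_le_iff₀ hc] at h2
  linarith [h2]

end Exponents

section Modification

variable {Ω : Type*} {mΩ : MeasurableSpace Ω} {P : Measure Ω} {p q : ℝ} {M : ℝ≥0}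
  {X : ℝ≥0 → Ω → E}

/-- The refined set of *good* sample points: for every exponent `holderExp p q j` and every `N`,
the increments of the path over consecutive level-`m` dyadics of `[0, N]` are eventually bounded
by `2 ^ (-holderExp p q j · m)`. [folklore] -/
def goodSetH (X : ℝ≥0 → Ω → E) (p q : ℝ) : Set Ω :=
  {ω | ∀ j N : ℕ, ∃ n₀ : ℕ, ∀ m, n₀ < m → ∀ k, k + 1 ≤ N * 2 ^ m →
    edist (X (dyad m k) ω) (X (dyad m (k + 1)) ω) ≤ ((2 : ℝ≥0∞) ^ (-holderExp p q j)) ^ m}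

/-- The refined good set is contained in the good set of the continuity part (exponent `j = 0`).
[folklore] -/
theorem goodSetH_subset_goodSet : goodSetH X p q ⊆ goodSet X p q := by
  intro ω hω N
  obtain ⟨n₀, hn₀⟩ := hω 0 N
  refine ⟨n₀, fun m hm k hk ↦ ?_⟩
  rw [← two_rpow_neg_holderExp_zero]
  exact hn₀ m hm k hk

/-- The refined good set is measurable. [folklore] -/
theorem measurableSet_goodSetH (hX : IsKolmogorovProcess X P p q M) :
    MeasurableSet (goodSetH X p q) := by
  have : goodSetH X p q = ⋂ j : ℕ, ⋂ N : ℕ, ⋃ n₀ : ℕ, ⋂ m : ℕ, ⋂ (_ : n₀ < m), ⋂ k : ℕ,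
      ⋂ (_ : k + 1 ≤ N * 2 ^ m),
        {ω | edist (X (dyad m k) ω) (X (dyad m (k + 1)) ω)
          ≤ ((2 : ℝ≥0∞) ^ (-holderExp p q j)) ^ m} := by
    ext ω
    simp only [goodSetH, mem_setOf_eq, mem_iInter, mem_iUnion]
  rw [this]
  exact MeasurableSet.iInter fun j ↦ MeasurableSet.iInter fun N ↦ MeasurableSet.iUnion fun n₀ ↦
    MeasurableSet.iInter fun m ↦ MeasurableSet.iInter fun _ ↦ MeasurableSet.iInter fun k ↦
      MeasurableSet.iInter fun _ ↦ measurableSet_le hX.measurable_edist measurable_const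

/-- Almost every sample point is in the refined good set (Borel–Cantelli for every exponent of
the sequence and every `N`). [cite: Legall2016, Thm 2.9] -/
theorem ae_mem_goodSetH (hX : IsKolmogorovProcess X P p q M) (hq : 1 < q) :
    ∀ᵐ ω ∂P, ω ∈ goodSetH X p q := by
  have := ae_all_iff.2 fun j ↦ ae_all_iff.2 fun N ↦
    ae_eventually_increments_le_rpow hX (holderExp_mul_lt hX.p_pos hq j) N
  filter_upwards [this] with ω hω j N
  obtain ⟨n₀, hn₀⟩ := eventually_atTop.1 (hω j N)
  exact ⟨n₀, fun m hm ↦ hn₀ m hm.le⟩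

open Classical in
/-- The locally Hölder modification: on the refined good set, the extension from the dyadics of
the path; elsewhere the constant path `X 0 ω` (documented junk value).
[cite: Legall2016, Thm 2.9] -/
noncomputable def modificationH (X : ℝ≥0 → Ω → E) (p q : ℝ) : ℝ≥0 → Ω → E :=
  fun t ω ↦ if ω ∈ goodSetH X p q then extendFrom dyadics (X · ω) t else X 0 ω

/-- On the refined good set the modification is the extension from the dyadics of the path.
[folklore] -/
theorem modificationH_apply_of_mem {t : ℝ≥0} {ω : Ω} (hω : ω ∈ goodSetH X p q) :
    modificationH X p q t ω = extendFrom dyadics (X · ω) t := by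
  simp [modificationH, hω]

/-- Off the refined good set the modification is the constant path `X 0 ω`. [folklore] -/
theorem modificationH_apply_of_not_mem {t : ℝ≥0} {ω : Ω} (hω : ω ∉ goodSetH X p q) :
    modificationH X p q t ω = X 0 ω := by
  simp [modificationH, hω]

variable [CompleteSpace E]

/-- Every path of the locally Hölder modification is continuous. [cite: Legall2016, Thm 2.9] -/
theorem continuous_modificationH (hp : 0 < p) (hq : 1 < q) (ω : Ω) :
    Continuous (fun t ↦ modificationH X p q t ω) := by
  by_cases hω : ω ∈ goodSetH X p q
  · simp only [modificationH_apply_of_mem hω]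
    exact (locallyUniformOnDyadics_of_mem_goodSet hp hq
      (goodSetH_subset_goodSet hω)).continuous_extendFrom
  · simp only [modificationH_apply_of_not_mem hω]
    exact continuous_const

/-- On the refined good set, the path converges within the dyadics to the modification.
[cite: Legall2016, Thm 2.9] -/
theorem tendsto_modificationH (hp : 0 < p) (hq : 1 < q) {ω : Ω} (hω : ω ∈ goodSetH X p q)
    (t : ℝ≥0) : Tendsto (X · ω) (𝓝[dyadics] t) (𝓝 (modificationH X p q t ω)) := by
  rw [modificationH_apply_of_mem hω]
  exact tendsto_extendFrom ((locallyUniformOnDyadics_of_mem_goodSet hp hq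
    (goodSetH_subset_goodSet hω)).exists_tendsto t)

end Modification

section Main

variable {E : Type*} [EMetricSpace E] [CompleteSpace E] {Ω : Type*} {mΩ : MeasurableSpace Ω}
  {P : Measure Ω} {p q : ℝ} {M : ℝ≥0} {X : ℝ≥0 → Ω → E}

omit [CompleteSpace E] in
/-- On the refined good set the modification agrees with the process at dyadic times.
[cite: Legall2016, Thm 2.9] -/
theorem modificationH_apply_of_mem_dyadics (hp : 0 < p) (hq : 1 < q) {ω : Ω}
    (hω : ω ∈ goodSetH X p q) {t : ℝ≥0} (ht : t ∈ dyadics) :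
    modificationH X p q t ω = X t ω := by
  rw [modificationH_apply_of_mem hω]
  exact extendFrom_eq (dense_dyadics t)
    ((locallyUniformOnDyadics_of_mem_goodSet hp hq (goodSetH_subset_goodSet hω)).tendsto_self ht)

section Measurable

variable [MeasurableSpace E] [BorelSpace E]

/-- Each marginal of the locally Hölder modification is measurable (pointwise limit of
`goodSetH.piecewise (X uᵢ) (X 0)` along dyadics `uᵢ → t`). [cite: Legall2016, Thm 2.9] -/
theorem measurable_modificationH (hX : IsKolmogorovProcess X P p q M) (hq : 1 < q) (t : ℝ≥0) :
    Measurable (modificationH X p q t) := by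
  classical
  set u : ℕ → ℝ≥0 := fun m ↦ dyad m ⌊(t : ℝ) * 2 ^ m⌋₊ with hu
  have hG := measurableSet_goodSetH hX
  refine measurable_of_tendsto_metrizable' atTop
    (f := fun i ↦ (goodSetH X p q).piecewise (X (u i)) (X 0))
    (fun i ↦ Measurable.piecewise hG (hX.measurable _) (hX.measurable _)) ?_
  rw [tendsto_pi_nhds]
  intro ω
  by_cases hω : ω ∈ goodSetH X p q
  · simp only [Set.piecewise_eq_of_mem _ _ _ hω]
    exact (tendsto_modificationH hX.p_pos hq hω t).comp (tendsto_dyad_floor t)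
  · simp only [Set.piecewise_eq_of_notMem _ _ _ hω, modificationH_apply_of_not_mem hω]
    exact tendsto_const_nhds

end Measurable

/-- The locally Hölder modification is a modification: `modificationH X p q t = X t` a.s.
[cite: Legall2016, Thm 2.9] -/
theorem modificationH_ae_eq (hX : IsKolmogorovProcess X P p q M) (hq : 1 < q) (t : ℝ≥0) :
    modificationH X p q t =ᵐ[P] X t := by
  set u : ℕ → ℝ≥0 := fun m ↦ dyad m ⌊(t : ℝ) * 2 ^ m⌋₊ with hu
  have hut : Tendsto u atTop (𝓝[dyadics] t) := tendsto_dyad_floor t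
  obtain ⟨ns, hns, hlim⟩ :=
    (tendstoInMeasure_of_tendsto hX (hut.mono_right nhdsWithin_le_nhds)).exists_seq_tendsto_ae
  filter_upwards [hlim, ae_mem_goodSetH hX hq] with ω hω₁ hω₂
  have h₂ : Tendsto (fun i ↦ X (u (ns i)) ω) atTop (𝓝 (modificationH X p q t ω)) :=
    (tendsto_modificationH hX.p_pos hq hω₂ t).comp (hut.comp hns.tendsto_atTop)
  exact tendsto_nhds_unique h₂ hω₁

/-- **Local Hölder continuity of the modification** (Le Gall 2016, Thm 2.9 and Remarks (i)–(ii)):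
every path of `modificationH X p q` is Hölder of order `γ` on every `[0, T]`, for every
`γ < (q - 1) / p`. [cite: Legall2016, Thm 2.9] -/
theorem exists_holderOnWith_modificationH (hp : 0 < p) (hq : 1 < q) {γ : ℝ≥0}
    (hγ : (γ : ℝ) < (q - 1) / p) (ω : Ω) (T : ℝ≥0) :
    ∃ C : ℝ≥0, HolderOnWith C γ (fun t ↦ modificationH X p q t ω) (Icc 0 T) := by
  by_cases hω : ω ∈ goodSetH X p q
  swap
  · refine ⟨0, fun x _ y _ ↦ ?_⟩
    simp [modificationH_apply_of_not_mem hω]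
  -- a dominating exponent of the sequence
  obtain ⟨j, hj⟩ := exists_le_holderExp hp hq hγ
  set γ' : ℝ := holderExp p q j with hγ'
  have hγ'pos : 0 < γ' := holderExp_pos hp hq j
  set γ'' : ℝ≥0 := ⟨γ', hγ'pos.le⟩ with hγ''
  have hγγ'' : γ ≤ γ'' := NNReal.coe_le_coe.1 hj
  -- the scale `n₀` on `[0, N]`, `N = ⌈T⌉`
  set N : ℕ := ⌈T⌉₊ with hN
  have hTN : T ≤ N := Nat.le_ceil T
  obtain ⟨n₀, hn₀⟩ := hω j N
  set Y : ℝ≥0 → E := fun t ↦ modificationH X p q t ω with hY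
  have hYc : Continuous Y := continuous_modificationH hp hq ω
  set C : ℝ≥0∞ := 2 * (1 - (2 : ℝ≥0∞) ^ (-γ')) ⁻¹ with hC
  have hCtop : C ≠ ∞ := by
    have hr : (2 : ℝ≥0∞) ^ (-γ') < 1 :=
      ENNReal.rpow_lt_one_of_one_lt_of_neg ENNReal.one_lt_two (neg_neg_of_pos hγ'pos)
    exact ENNReal.mul_ne_top ENNReal.ofNat_ne_top (ENNReal.inv_ne_top.2 (tsub_pos_of_lt hr).ne')
  -- Hölder bound on the dyadics of `[0, N]`, transferred to `Y`
  have hdy : ∀ s ∈ dyadics, ∀ t ∈ dyadics, s ≤ N → t ≤ N → dist s t < (2 ^ n₀)⁻¹ →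
      edist (Y s) (Y t) ≤ C * edist s t ^ γ' := by
    intro s hs t ht hsN htN hd
    simp only [hY, modificationH_apply_of_mem_dyadics hp hq hω hs,
      modificationH_apply_of_mem_dyadics hp hq hω ht]
    exact edist_le_mul_rpow_of_increments_le (f := fun t ↦ X t ω) hγ'pos hn₀ hs ht hsN htN hd
  -- all points of `[0, T]` near the diagonal
  have hloc : ∀ s t : ℝ≥0, s ≤ T → t ≤ T → dist s t < (2 ^ n₀)⁻¹ →
      edist (Y s) (Y t) ≤ C * edist s t ^ ((γ'' : ℝ≥0) : ℝ) := fun s t hs ht hd ↦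
    edist_le_mul_rpow_of_dyadics hYc hCtop hdy (hs.trans hTN) (ht.trans hTN) hd
  obtain ⟨C', hC'⟩ := exists_holderOnWith_of_local hCtop (by positivity) hloc
  -- decrease the exponent on the bounded set `[0, T]`
  refine ⟨C' * T ^ ((γ'' : ℝ) - γ), hC'.of_le (fun x hx y hy ↦ ?_) hγγ''⟩
  rw [edist_nndist, ENNReal.coe_le_coe, NNReal.nndist_eq]
  exact max_le ((tsub_le_self).trans hx.2) ((tsub_le_self).trans hy.2)

end Main

end KolmogorovChentsov

open KolmogorovChentsov in
/-- **Kolmogorov–Chentsov theorem on `ℝ≥0`, Hölder form** (Le Gall 2016, Thm 2.9 with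
Remarks (i)–(ii); Kallenberg 2002, Thm 3.23; Degenne–Ledvinka–Marion–Pfaffelhuber,
arXiv:2511.20118, Thm 4.21). A process `X : ℝ≥0 → Ω → E` with values in a complete (extended)
metric space with its Borel σ-algebra which satisfies the Kolmogorov condition
`IsKolmogorovProcess X P p q M` with `q > 1` has a modification `Y` with measurable marginals,
all of whose paths are continuous and Hölder continuous of order `γ` on every `[0, T]`, for
every `γ < (q - 1) / p`. No finiteness assumption on `P`. [cite: Legall2016, Thm 2.9] -/
theorem exists_modification_holder_of_isKolmogorovProcess
    {E : Type*} [EMetricSpace E] [CompleteSpace E] [MeasurableSpace E] [BorelSpace E]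
    {Ω : Type*} {mΩ : MeasurableSpace Ω} {P : Measure Ω} {p q : ℝ} {M : ℝ≥0} {X : ℝ≥0 → Ω → E}
    (hX : IsKolmogorovProcess X P p q M) (hq : 1 < q) :
    ∃ Y : ℝ≥0 → Ω → E, (∀ t, Y t =ᵐ[P] X t) ∧ (∀ t, Measurable (Y t)) ∧
      (∀ ω, Continuous (Y · ω)) ∧
      ∀ γ : ℝ≥0, (γ : ℝ) < (q - 1) / p → ∀ (ω : Ω) (T : ℝ≥0),
        ∃ C : ℝ≥0, HolderOnWith C γ (Y · ω) (Set.Icc 0 T) :=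
  ⟨modificationH X p q, modificationH_ae_eq hX hq, measurable_modificationH hX hq,
    continuous_modificationH hX.p_pos hq,
    fun _ hγ ω T ↦ exists_holderOnWith_modificationH hX.p_pos hq hγ ω T⟩

end Literature.Probability.Process
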